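import Summits.BirchSwinnertonDyer.BirchSwinnertonDyer.Theorems.GenusKolyvaginAtTwoGenusPrimitiveSupplyAtTwoArchimedeanTransverse
import HarnessLib

/-!
# Route `GenusKolyvaginAtTwo`, crux #2 `GenusPrimitiveSupplyAtTwo` (stmt-BirchSwinnertonDyer-22136):
# NORM CLASSES LIE IN BOTH KUMMER CONDITIONS — the `⊇` half of Mazur–Rubin Lemma 2.9 (Kramer Prop. 7) at EVERY place,
# for the canonical identification `E^{(d)}[2] ≅ E[2]`: `κ_E(Q + τ₀Q) = φ_* κ_{E^{(d)}}(θ⁻¹(Q − τ₀Q))`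

Width seat `bsd-line-gk2-p5` g10 (cell `bsd-f1-sign2`, SUPPLY lineage), file 34 of the series (sequel of
`…ArchimedeanTransverse.lean` p636791, whose §57 is the `∩ = 0` statement at a real place). THEOREMS ONLY (no definition, no named
fact, no `sorry`, no local instance); helper `--supports stmt-BirchSwinnertonDyer-22136`; no item is closed; BSD is not proved by any of this.

WHAT. Mazur–Rubin Lemma 2.9 [MazurRubin2010, p. 548] (= Kramer 1981 Prop. 7, Mazur–Rubin 2007 Prop. 5.2): under the identification
`H¹_f(K_v, E[2]) = E(K_v)/2E(K_v)`, `H¹_f(K_v, E[2]) ∩ H¹_f(K_v, E^F[2]) = N E(F_w)/2E(K_v)`, `F = K(√d)`. This file proves the inclusion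
`⊇` at an ARBITRARY `K`-field `E` (a completion `K_v`, finite or infinite) in the tree's currency: `W, Wd = C • W^{(d)}` over a number
field `K`, the canonical pair (`χ : Wd[2] → W[2]` intertwining, `θ_E : Wd(K̄_E) ≃+ W(K̄_E)` with the sign rule of g8's
`exists_addEquiv_geomTorsion_two_localSquare_signed`: `θ(σQ) = σθ(Q)` if `σ` fixes `ι√d`, `= −σθ(Q)` if `σ` flips it), `τ₀ ∈ Γ_E`
flipping `ι√d` (so `d ∉ E²`), and `Q ∈ W(K̄_E)` fixed by every `σ` fixing `ι√d` («`Q ∈ E(F_w)`»):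

* §82 group-action bookkeeping for the index-`2` subgroup `{σ : σ ι√d = ι√d}`: `smul_eq_smul_of_flip` (`σQ = τ₀Q` for flipping `σ`),
  `smul_smul_eq_of_flip_of_flip`, `smul_smul_eq_of_fix`, `norm_mem_fixedPoints` (`Q + τ₀Q ∈ W(K̄_E)^{Γ_E}`),
  `symm_antiNorm_mem_fixedPoints` (`θ⁻¹(Q − τ₀Q) ∈ Wd(K̄_E)^{Γ_E}`);
* §83 **`localKummerClass_norm_eq_map`** — with `S + S = Q`, `R₀ = S + τ₀S` (`2R₀ = Q + τ₀Q`) and `R' = θ⁻¹(S − τ₀S)` (`2R' = θ⁻¹(Q − τ₀Q)`):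
  `κ_W(R₀) = H¹(χ)(κ_{Wd}(R'))` — the two local Kummer COCYCLES coincide (`τ ↦ τR₀ − R₀` vs `τ ↦ θ(τR' − R') = ±τ(S − τ₀S) − (S − τ₀S)`;
  for `τ` fixing: `2ττ₀S = τ(τ₀Q) = τ₀Q`; for `τ` flipping: `2τS = τQ = τ₀Q`); **`localKummerClass_norm_mem_map_kummerLocalConditionAt`** —
  the local Kummer class of ANY half `R` of a norm `Q + τ₀Q` lies in the transported condition `φ_* 𝓛_E(Wd)`;
  **`kummerLocalConditionAt_le_map_of_forall_exists_norm`** — if every `Γ_E`-fixed point of `W(K̄_E)` is such a norm (Mazur: good reduction,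
  `E(√d)/E` unramified — tree `KramerTunnell1982/GoodReductionUnramifiedNormIndexProofs`), then `𝓛_E(W) ≤ φ_* 𝓛_E(Wd)` — the engine of
  Lemma 2.10 (v) at a DYADIC place (the one row of `MazurRubin2010.d2_eq_of_lemma210_rat` not yet discharged, lead g9 memo §3), whose
  remaining inputs are the norm-surjectivity bridge and the count `#𝓛_E(W) = #𝓛_E(Wd)`.

References: [MazurRubin2010] Lemma 2.9 (p. 548), Lemma 2.10 (v); [Kramer1981] Prop. 7, eq. (11); [MazurRubin2007] Prop. 5.2;
[SilvermanAEC2009] VIII.§2, X.§4, X.5 Cor. 5.4.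
-/

set_option linter.dupNamespace false -- tree convention: `Summit.BirchSwinnertonDyer.BirchSwinnertonDyer.Theorems` (summit = sub-problem)
set_option autoImplicit false

noncomputable section

open scoped Classical ContRepresentation

namespace Summit.BirchSwinnertonDyer.BirchSwinnertonDyer.Theorems.GenusKolyArch

open WeierstrassCurve Field NumberField Function
open Literature.NumberTheory.EllipticCurves Literature.NumberTheory.GaloisRepresentations

universe u

/-! ## §82 The index-`2` subgroup fixing `ι√d` acting on `W(K̄_E)` -/

section Index

variable {K : Type u} [Field K] (W : WeierstrassCurve K) {d : K} (E : Type u) [Field E] [Algebra K E]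

omit W in
/-- If `τ₀` flips `ι√d` then `τ₀⁻¹` flips it. [folklore] -/
theorem inv_apply_geomSqrt_eq_neg {τ₀ : absoluteGaloisGroup E}
    (hτ₀ : (show AlgebraicClosure E ≃ₐ[E] AlgebraicClosure E from τ₀) (closureEmb (K := K) E (geomSqrt d)) =
      -closureEmb (K := K) E (geomSqrt d)) :
    (show AlgebraicClosure E ≃ₐ[E] AlgebraicClosure E from τ₀⁻¹) (closureEmb (K := K) E (geomSqrt d)) =
      -closureEmb (K := K) E (geomSqrt d) := by
  set x := closureEmb (K := K) E (geomSqrt d) with hx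
  have h1 : (show AlgebraicClosure E ≃ₐ[E] AlgebraicClosure E from τ₀⁻¹)
      ((show AlgebraicClosure E ≃ₐ[E] AlgebraicClosure E from τ₀) x) = x := by
    change (show AlgebraicClosure E ≃ₐ[E] AlgebraicClosure E from (τ₀⁻¹ * τ₀)) x = x
    rw [inv_mul_cancel]
    rfl
  rw [hτ₀, map_neg, neg_eq_iff_eq_neg] at h1
  exact h1

omit W in
/-- Products: fix ∘ flip flips. [folklore] -/
theorem mul_apply_geomSqrt_of_fix_of_flip {σ τ : absoluteGaloisGroup E}
    (hσ : (show AlgebraicClosure E ≃ₐ[E] AlgebraicClosure E from σ) (closureEmb (K := K) E (geomSqrt d)) =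
      closureEmb (K := K) E (geomSqrt d))
    (hτ : (show AlgebraicClosure E ≃ₐ[E] AlgebraicClosure E from τ) (closureEmb (K := K) E (geomSqrt d)) =
      -closureEmb (K := K) E (geomSqrt d)) :
    (show AlgebraicClosure E ≃ₐ[E] AlgebraicClosure E from σ * τ) (closureEmb (K := K) E (geomSqrt d)) =
      -closureEmb (K := K) E (geomSqrt d) := by
  change (show AlgebraicClosure E ≃ₐ[E] AlgebraicClosure E from σ)
    ((show AlgebraicClosure E ≃ₐ[E] AlgebraicClosure E from τ) (closureEmb (K := K) E (geomSqrt d))) = _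
  rw [hτ, map_neg, hσ]

omit W in
/-- Products: flip ∘ flip fixes. [folklore] -/
theorem mul_apply_geomSqrt_of_flip_of_flip {σ τ : absoluteGaloisGroup E}
    (hσ : (show AlgebraicClosure E ≃ₐ[E] AlgebraicClosure E from σ) (closureEmb (K := K) E (geomSqrt d)) =
      -closureEmb (K := K) E (geomSqrt d))
    (hτ : (show AlgebraicClosure E ≃ₐ[E] AlgebraicClosure E from τ) (closureEmb (K := K) E (geomSqrt d)) =
      -closureEmb (K := K) E (geomSqrt d)) :
    (show AlgebraicClosure E ≃ₐ[E] AlgebraicClosure E from σ * τ) (closureEmb (K := K) E (geomSqrt d)) =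
      closureEmb (K := K) E (geomSqrt d) := by
  change (show AlgebraicClosure E ≃ₐ[E] AlgebraicClosure E from σ)
    ((show AlgebraicClosure E ≃ₐ[E] AlgebraicClosure E from τ) (closureEmb (K := K) E (geomSqrt d))) = _
  rw [hτ, map_neg, hσ, neg_neg]

variable {E}
variable {τ₀ : absoluteGaloisGroup E}
  (hτ₀ : (show AlgebraicClosure E ≃ₐ[E] AlgebraicClosure E from τ₀) (closureEmb (K := K) E (geomSqrt d)) =
    -closureEmb (K := K) E (geomSqrt d))
  {Q : localPoints W E}
  (hQ : ∀ σ : absoluteGaloisGroup E,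
    (show AlgebraicClosure E ≃ₐ[E] AlgebraicClosure E from σ) (closureEmb (K := K) E (geomSqrt d)) =
      closureEmb (K := K) E (geomSqrt d) → σ • Q = Q)

include hτ₀ hQ in
/-- **A point of `E(F_w)` has the same image under every `σ` flipping `ι√d`:** `σQ = τ₀Q` (`τ₀⁻¹σ` fixes `ι√d`, hence `Q`). [folklore] -/
theorem smul_eq_smul_of_flip {σ : absoluteGaloisGroup E}
    (hσ : (show AlgebraicClosure E ≃ₐ[E] AlgebraicClosure E from σ) (closureEmb (K := K) E (geomSqrt d)) =
      -closureEmb (K := K) E (geomSqrt d)) :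
    σ • Q = τ₀ • Q := by
  have hfix := mul_apply_geomSqrt_of_flip_of_flip E (inv_apply_geomSqrt_eq_neg E hτ₀) hσ
  have h := hQ (τ₀⁻¹ * σ) hfix
  rw [mul_smul, inv_smul_eq_iff] at h
  exact h

include hQ in
/-- `σ(τQ) = Q` when `σ` and `τ` both flip `ι√d`. [folklore] -/
theorem smul_smul_eq_of_flip_of_flip {σ τ : absoluteGaloisGroup E}
    (hσ : (show AlgebraicClosure E ≃ₐ[E] AlgebraicClosure E from σ) (closureEmb (K := K) E (geomSqrt d)) =
      -closureEmb (K := K) E (geomSqrt d))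
    (hτ : (show AlgebraicClosure E ≃ₐ[E] AlgebraicClosure E from τ) (closureEmb (K := K) E (geomSqrt d)) =
      -closureEmb (K := K) E (geomSqrt d)) :
    σ • τ • Q = Q := by
  rw [← mul_smul]
  exact hQ _ (mul_apply_geomSqrt_of_flip_of_flip E hσ hτ)

include hτ₀ hQ in
/-- `σ(τ₀Q) = τ₀Q` when `σ` fixes `ι√d` (`στ₀` flips). [folklore] -/
theorem smul_smul_eq_of_fix {σ : absoluteGaloisGroup E}
    (hσ : (show AlgebraicClosure E ≃ₐ[E] AlgebraicClosure E from σ) (closureEmb (K := K) E (geomSqrt d)) =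
      closureEmb (K := K) E (geomSqrt d)) :
    σ • τ₀ • Q = τ₀ • Q := by
  rw [← mul_smul]
  exact smul_eq_smul_of_flip W hτ₀ hQ (mul_apply_geomSqrt_of_fix_of_flip E hσ hτ₀)

variable
  (hdich : ∀ σ : absoluteGaloisGroup E,
    (show AlgebraicClosure E ≃ₐ[E] AlgebraicClosure E from σ) (closureEmb (K := K) E (geomSqrt d)) =
        closureEmb (K := K) E (geomSqrt d) ∨
      (show AlgebraicClosure E ≃ₐ[E] AlgebraicClosure E from σ) (closureEmb (K := K) E (geomSqrt d)) =
        -closureEmb (K := K) E (geomSqrt d))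

include hτ₀ hQ hdich in
/-- **The norm `Q + τ₀Q` of a point of `E(F_w)` is `Γ_E`-fixed** (`∈ E(E)`). [cite: MazurRubin2010, Definition 2.6] -/
theorem norm_mem_fixedPoints : Q + τ₀ • Q ∈ MulAction.fixedPoints (absoluteGaloisGroup E) (localPoints W E) := by
  intro σ
  rw [smul_add]
  rcases hdich σ with hσ | hσ
  · rw [hQ σ hσ, smul_smul_eq_of_fix W hτ₀ hQ hσ]
  · rw [smul_eq_smul_of_flip W hτ₀ hQ hσ, smul_smul_eq_of_flip_of_flip W hQ hσ hτ₀, add_comm]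

variable {Wd : WeierstrassCurve K} (θ : localPoints Wd E ≃+ localPoints W E)
  (hfix : ∀ σ : absoluteGaloisGroup E,
    (show AlgebraicClosure E ≃ₐ[E] AlgebraicClosure E from σ) (closureEmb (K := K) E (geomSqrt d)) =
      closureEmb (K := K) E (geomSqrt d) → ∀ P : localPoints Wd E, θ (σ • P) = σ • θ P)
  (hneg : ∀ σ : absoluteGaloisGroup E,
    (show AlgebraicClosure E ≃ₐ[E] AlgebraicClosure E from σ) (closureEmb (K := K) E (geomSqrt d)) =
      -closureEmb (K := K) E (geomSqrt d) → ∀ P : localPoints Wd E, θ (σ • P) = -(σ • θ P))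

include hfix in
/-- Transport of the action through `θ⁻¹` at a fixing `σ`. [folklore] -/
theorem smul_symm_of_fix {σ : absoluteGaloisGroup E}
    (hσ : (show AlgebraicClosure E ≃ₐ[E] AlgebraicClosure E from σ) (closureEmb (K := K) E (geomSqrt d)) =
      closureEmb (K := K) E (geomSqrt d)) (X : localPoints W E) :
    σ • θ.symm X = θ.symm (σ • X) := by
  apply θ.injective
  rw [hfix σ hσ, AddEquiv.apply_symm_apply, AddEquiv.apply_symm_apply]

include hneg in
/-- Transport of the action through `θ⁻¹` at a flipping `σ` (sign). [folklore] -/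
theorem smul_symm_of_flip {σ : absoluteGaloisGroup E}
    (hσ : (show AlgebraicClosure E ≃ₐ[E] AlgebraicClosure E from σ) (closureEmb (K := K) E (geomSqrt d)) =
      -closureEmb (K := K) E (geomSqrt d)) (X : localPoints W E) :
    σ • θ.symm X = θ.symm (-(σ • X)) := by
  apply θ.injective
  rw [hneg σ hσ, AddEquiv.apply_symm_apply, AddEquiv.apply_symm_apply]

include hτ₀ hQ hdich hfix hneg in
/-- **The anti-norm transported to the twist is `Γ_E`-fixed**: `θ⁻¹(X − τ₀X) ∈ Wd(K̄_E)^{Γ_E}` for every `X` with `X` fixed by the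
fixing `σ`'s (here `X = Q`; the twisted point of `E^{(d)}(E)` corresponding to `Q − τ₀Q ∈ E(F_w)^{−}`). [cite: MazurRubin2010, Lemma 2.9 (proof)] -/
theorem symm_antiNorm_mem_fixedPoints :
    θ.symm (Q - τ₀ • Q) ∈ MulAction.fixedPoints (absoluteGaloisGroup E) (localPoints Wd E) := by
  intro σ
  rcases hdich σ with hσ | hσ
  · rw [smul_symm_of_fix W θ hfix hσ, smul_sub, hQ σ hσ, smul_smul_eq_of_fix W hτ₀ hQ hσ]
  · rw [smul_symm_of_flip W θ hneg hσ, smul_sub, smul_eq_smul_of_flip W hτ₀ hQ hσ,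
      smul_smul_eq_of_flip_of_flip W hQ hσ hτ₀, neg_sub]

end Index

/-! ## §83 The norm class is the transported twisted Kummer class -/

section NormClass

variable {K : Type u} [Field K] [NumberField K] (W : WeierstrassCurve K) [W.IsElliptic]
  {Wd : WeierstrassCurve K} [Wd.IsElliptic] {d : K} (E : Type u) [Field E] [Algebra K E]
  (χ : (Wd.torsionGaloisModule ((2 : ℕ) : ℤ)).toContRepresentation →ⁱL
    (W.torsionGaloisModule ((2 : ℕ) : ℤ)).toContRepresentation)
  (θ : localPoints Wd E ≃+ localPoints W E)
  (hfix : ∀ σ : absoluteGaloisGroup E,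
    (show AlgebraicClosure E ≃ₐ[E] AlgebraicClosure E from σ) (closureEmb (K := K) E (geomSqrt d)) =
      closureEmb (K := K) E (geomSqrt d) → ∀ P : localPoints Wd E, θ (σ • P) = σ • θ P)
  (hneg : ∀ σ : absoluteGaloisGroup E,
    (show AlgebraicClosure E ≃ₐ[E] AlgebraicClosure E from σ) (closureEmb (K := K) E (geomSqrt d)) =
      -closureEmb (K := K) E (geomSqrt d) → ∀ P : localPoints Wd E, θ (σ • P) = -(σ • θ P))
  (hdich : ∀ σ : absoluteGaloisGroup E,
    (show AlgebraicClosure E ≃ₐ[E] AlgebraicClosure E from σ) (closureEmb (K := K) E (geomSqrt d)) =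
        closureEmb (K := K) E (geomSqrt d) ∨
      (show AlgebraicClosure E ≃ₐ[E] AlgebraicClosure E from σ) (closureEmb (K := K) E (geomSqrt d)) =
        -closureEmb (K := K) E (geomSqrt d))
  (hχ : ∀ t : geomTorsion Wd ((2 : ℕ) : ℤ),
    pointsMap W E (χ t : geomPoints W) = θ (pointsMap Wd E (t : geomPoints Wd)))
  {τ₀ : absoluteGaloisGroup E}
  (hτ₀ : (show AlgebraicClosure E ≃ₐ[E] AlgebraicClosure E from τ₀) (closureEmb (K := K) E (geomSqrt d)) =
    -closureEmb (K := K) E (geomSqrt d))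
  {Q : localPoints W E}
  (hQ : ∀ σ : absoluteGaloisGroup E,
    (show AlgebraicClosure E ≃ₐ[E] AlgebraicClosure E from σ) (closureEmb (K := K) E (geomSqrt d)) =
      closureEmb (K := K) E (geomSqrt d) → σ • Q = Q)

/-- `2 ≠ 0` in `ℤ` (the level of the Kummer classes). [folklore] -/
private theorem two_ne_zero' : ((2 : ℕ) : ℤ) ≠ 0 := by norm_num

include hfix hneg hdich hχ hτ₀ hQ in
/-- **The norm class is the transported twisted class — at the level of COCYCLES.** With `S + S = Q`, `R₀ = S + τ₀S` and
`R' = θ⁻¹(S − τ₀S)`: `κ_W(R₀) = H¹(χ)(κ_{Wd}(R'))` in `H¹(Γ_E, W[2])`, because the two crossed homomorphisms agree: at `τ` fixing `ι√d`,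
`τR₀ − R₀ = θ(τR' − R')` reduces to `2τ(τ₀S) = 2τ₀S`, i.e. `τ(τ₀Q) = τ₀Q`; at `τ` flipping, to `2τS = 2τ₀S`, i.e. `τQ = τ₀Q`.
[cite: MazurRubin2010, Lemma 2.9] [cite: Kramer1981, Prop. 7] -/
theorem localKummerClass_norm_eq_map {S : localPoints W E} (hS : S + S = Q)
    (hR₀ : ((2 : ℕ) : ℤ) • (S + τ₀ • S) ∈ MulAction.fixedPoints (absoluteGaloisGroup E) (localPoints W E))
    (hR' : ((2 : ℕ) : ℤ) • θ.symm (S - τ₀ • S) ∈ MulAction.fixedPoints (absoluteGaloisGroup E) (localPoints Wd E)) :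
    W.localKummerClass ((2 : ℕ) : ℤ) two_ne_zero' (S + τ₀ • S) hR₀ =
      galoisCohomology.map (χ.restrictField E) 1 (Wd.localKummerClass ((2 : ℕ) : ℤ) two_ne_zero' (θ.symm (S - τ₀ • S)) hR') := by
  unfold WeierstrassCurve.localKummerClass
  rw [galoisCohomology.map_one_oneCocycleClass]
  congr 1
  apply Subtype.ext
  ext σ : 1
  -- compare the values in `W(K̄_E)` along the injective `pointsMap ∘ Subtype.val`
  have hinj : Function.Injective fun t : geomTorsion W ((2 : ℕ) : ℤ) ↦ pointsMap W E (t : geomPoints W) :=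
    fun a b h ↦ Subtype.ext (pointsMapOfEmb_injective W _ h)
  apply hinj
  change pointsMap W E ((W.localKummerCocycle ((2 : ℕ) : ℤ) two_ne_zero' (S + τ₀ • S) hR₀).1 σ : geomPoints W) =
    pointsMap W E ((χ ((Wd.localKummerCocycle ((2 : ℕ) : ℤ) two_ne_zero' (θ.symm (S - τ₀ • S)) hR').1 σ) :
      geomTorsion W ((2 : ℕ) : ℤ)) : geomPoints W)
  rw [pointsMap_localKummerCocycle_apply, hχ, pointsMap_localKummerCocycle_apply, map_sub, AddEquiv.apply_symm_apply]
  -- `2τ₀S = τ₀Q`, `2σS`, `2στ₀S`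
  have h2τ₀S : τ₀ • S + τ₀ • S = τ₀ • Q := by rw [← smul_add, hS]
  rcases hdich σ with hσ | hσ
  · -- `σ` fixes `ι√d`: `θ(σR') = σ(S − τ₀S)`
    rw [hfix σ hσ, AddEquiv.apply_symm_apply, smul_sub, smul_add]
    have hY : σ • τ₀ • S + σ • τ₀ • S = τ₀ • S + τ₀ • S := by
      rw [← smul_add, h2τ₀S, smul_smul_eq_of_fix W hτ₀ hQ hσ]
    calc σ • S + σ • τ₀ • S - (S + τ₀ • S)
        = σ • S - σ • τ₀ • S - (S - τ₀ • S) + (σ • τ₀ • S + σ • τ₀ • S - (τ₀ • S + τ₀ • S)) := by abel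
      _ = σ • S - σ • τ₀ • S - (S - τ₀ • S) := by rw [hY, sub_self, add_zero]
  · -- `σ` flips `ι√d`: `θ(σR') = −σ(S − τ₀S)`
    rw [hneg σ hσ, AddEquiv.apply_symm_apply, smul_sub, smul_add]
    have hX : σ • S + σ • S = τ₀ • S + τ₀ • S := by
      rw [← smul_add, hS, h2τ₀S, smul_eq_smul_of_flip W hτ₀ hQ hσ]
    calc σ • S + σ • τ₀ • S - (S + τ₀ • S)
        = -(σ • S - σ • τ₀ • S) - (S - τ₀ • S) + (σ • S + σ • S - (τ₀ • S + τ₀ • S)) := by abel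
      _ = -(σ • S - σ • τ₀ • S) - (S - τ₀ • S) := by rw [hX, sub_self, add_zero]

include hfix hneg hdich hχ hτ₀ hQ in
/-- **NORM CLASSES LIE IN THE TRANSPORTED TWISTED KUMMER CONDITION** (the `⊇` half of Mazur–Rubin Lemma 2.9 at the `K`-field `E`): for
`Q ∈ W(K̄_E)` fixed by every `σ` fixing `ι√d` and ANY `R ∈ W(K̄_E)` with `2R = Q + τ₀Q`, the local Kummer class `κ_E(R) = [σ ↦ σR − R]`
of the `E`-rational point `Q + τ₀Q` lies in `H¹(χ)(𝓛_E(Wd))`. (It lies in `𝓛_E(W)` by `localKummerClass_mem_kummerLocalConditionAt`.)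
[cite: MazurRubin2010, Lemma 2.9] [cite: Kramer1981, Prop. 7] -/
theorem localKummerClass_norm_mem_map_kummerLocalConditionAt (R : localPoints W E)
    (hR2 : ((2 : ℕ) : ℤ) • R = Q + τ₀ • Q)
    (hR : ((2 : ℕ) : ℤ) • R ∈ MulAction.fixedPoints (absoluteGaloisGroup E) (localPoints W E)) :
    W.localKummerClass ((2 : ℕ) : ℤ) two_ne_zero' R hR ∈
      (Wd.kummerLocalConditionAt ((2 : ℕ) : ℤ) E).map (galoisCohomology.map (χ.restrictField E) 1) := by
  obtain ⟨S, hS⟩ := exists_add_self_eq_localPoints W E Q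
  have hN := norm_mem_fixedPoints W hτ₀ hQ hdich
  have h2R₀ : ((2 : ℕ) : ℤ) • (S + τ₀ • S) = Q + τ₀ • Q := by
    rw [Nat.cast_ofNat, two_zsmul, ← hS, smul_add]
    abel
  have hR₀ : ((2 : ℕ) : ℤ) • (S + τ₀ • S) ∈ MulAction.fixedPoints (absoluteGaloisGroup E) (localPoints W E) := by
    rw [h2R₀]; exact hN
  have h2R' : ((2 : ℕ) : ℤ) • θ.symm (S - τ₀ • S) = θ.symm (Q - τ₀ • Q) := by
    rw [← map_zsmul, Nat.cast_ofNat, two_zsmul, ← hS, smul_add]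
    congr 1
    abel
  have hR' : ((2 : ℕ) : ℤ) • θ.symm (S - τ₀ • S) ∈ MulAction.fixedPoints (absoluteGaloisGroup E) (localPoints Wd E) := by
    rw [h2R']; exact symm_antiNorm_mem_fixedPoints W hτ₀ hQ hdich θ hfix hneg
  rw [W.localKummerClass_eq_of_zsmul_eq ((2 : ℕ) : ℤ) two_ne_zero' R (S + τ₀ • S) hR hR₀ (by rw [hR2, h2R₀]),
    localKummerClass_norm_eq_map W E χ θ hfix hneg hdich hχ hτ₀ hQ hS hR₀ hR']
  exact AddSubgroup.mem_map_of_mem _ (Wd.localKummerClass_mem_kummerLocalConditionAt _ _ _ _)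

include hfix hneg hdich hχ hτ₀ in
/-- **`𝓛_E(W) ≤ φ_* 𝓛_E(Wd)` when every `E`-rational point is a norm** (the engine of Mazur–Rubin Lemma 2.10 (v) at a dyadic place):
if every `Γ_E`-fixed `P ∈ W(K̄_E)` is `Q + τ₀Q` for some `Q` fixed by the `σ`'s fixing `ι√d` (Mazur's norm surjectivity for good
reduction in the unramified `E(√d)/E`; tree `KramerTunnell1982.relIndex_normSubgroup_fixedSubgroup_eq_one_of_isUnit_Δ`), then the
local Kummer condition of `W` is contained in the transported one of `Wd`; with `#𝓛_E(W) = #𝓛_E(Wd)` (same `2`-torsion, same degree)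
this is the equality of Lemma 2.10 (v). [cite: MazurRubin2010, Lemma 2.9 and Lemma 2.10 (v)] [cite: Kramer1981, Prop. 3, Prop. 7] -/
theorem kummerLocalConditionAt_le_map_of_forall_exists_norm
    (hnorm : ∀ P ∈ MulAction.fixedPoints (absoluteGaloisGroup E) (localPoints W E),
      ∃ Q : localPoints W E, (∀ σ : absoluteGaloisGroup E,
        (show AlgebraicClosure E ≃ₐ[E] AlgebraicClosure E from σ) (closureEmb (K := K) E (geomSqrt d)) =
          closureEmb (K := K) E (geomSqrt d) → σ • Q = Q) ∧ Q + τ₀ • Q = P) :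
    W.kummerLocalConditionAt ((2 : ℕ) : ℤ) E ≤
      (Wd.kummerLocalConditionAt ((2 : ℕ) : ℤ) E).map (galoisCohomology.map (χ.restrictField E) 1) := by
  intro c hc
  obtain ⟨R, hR, rfl⟩ := (W.mem_kummerLocalConditionAt_iff_exists_eq_localKummerClass ((2 : ℕ) : ℤ) two_ne_zero' c).mp hc
  obtain ⟨Q, hQ, hP⟩ := hnorm _ hR
  exact localKummerClass_norm_mem_map_kummerLocalConditionAt W E χ θ hfix hneg hdich hχ hτ₀ hQ R hP.symm hR

end NormClass

end Summit.BirchSwinnertonDyer.BirchSwinnertonDyer.Theorems.GenusKolyArch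

end
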